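import Mathlib
import Summits.NavierStokesRegularity.NavierStokesRegularity.Theorems.EulerZoomLiouvillePowerGaugeEulerLiouvilleSwirlCapacityPlaneTwoPole
import HarnessLib

/-!
# Crux `EulerZoomLiouville.PowerGaugeEulerLiouville` (stmt-NavierStokesRegularity-19832), line `swirl-capacity`, stub D2 (log-sharp form) —
# tool 3: THE LAYER-CAKE BOUND FOR THE LOGARITHMIC KERNEL ON AN ARBITRARY MEASURABLE SET

Route №10 `EulerZoomLiouville` (NavierStokesRegularity), crux E, line `swirl-capacity`, stub `stub_axisCapacityFloor` (D2, log-sharp).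
Continuing `…SwirlCapacityPlaneTwoPole` (`twoPole_log_le`: `K(y,y') = ∫_{|x|≤R} dA(x)/(|x−y||x−y'|) ≤ 4π(1 + log(4R/|y−y'|))`), this file
integrates the logarithm over an ARBITRARY measurable set `S` of the disc — which is what the D3 consumer needs, since the swirl-blob avatar `T`
delivered by D1 is a bare measurable set — WITHOUT rearrangement:

* `ofReal_log_le_lintegral_indicator` — `log(4R/s) ≤ ∫_{(0,4R)} 1_{s<r} dr/r`;
* `lintegral_log_le` — **`∫_S log(4R/|y−y'|) dA(y') ≤ (|S|/2)(1 + log(16πR²/|S|))`** for every `y` (Tonelli turns the left side into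
  `∫_0^{4R} |S ∩ B(y,r)| dr/r`, and `|S ∩ B(y,r)| ≤ min(πr², |S|)` with the switch at `πr⋆² = |S|`; equality for the disc centred at `y`, i.e.
  the bathtub value is reached without symmetrising);
* `doublePole_le` — **`∫_S∫_S K(y,y') ≤ 2π |S|² (3 + log (16πR²/|S|))`**, i.e. `‖U_S‖²_{L²(B̄_R)} ≲ |S|² log(R²/|S|)` for the Newtonian
  potential of `S`: the logarithmic growth that makes the planar capacity of a set of area `|S|` in a disc of radius `R` at least
  `≍ 1/log(R²/|S|)` (cf. Maz'ya's capacity–area inequality, here replaced by an elementary potential estimate).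

WHAT THIS IS NOT: not NS, not the crux, not D2 — a `--supports` tool for stmt-19832 (pure real analysis in the plane); no summit statement is
proved here.  [folklore; cf. Mazja1985, §2.2.3 (6)]
-/

noncomputable section

-- flat `Theorems/<Route><Decl>…` files of one crux share the namespace of the crux (tree convention)
set_option linter.dupNamespace false

open MeasureTheory Set Filter Topology Metric Function Real
open scoped NNReal ENNReal

namespace Summit.NavierStokesRegularity.NavierStokesRegularity.Theorems.PowerGaugeEulerLiouville.SwirlCapacity

/-! ### The layer-cake bound for the logarithmic kernel on an arbitrary measurable set -/

/-- `log (4R/s) ≤ ∫_{(0,4R)} 1_{s<r} dr/r` for `s ≥ 0` (equality for `0 < s < 4R`; the left side vanishes otherwise). [folklore] -/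
theorem ofReal_log_le_lintegral_indicator {R s : ℝ} (hR : 0 < R) (hs : 0 ≤ s) :
    ENNReal.ofReal (Real.log (4 * R / s)) ≤ ∫⁻ r in Ioo 0 (4 * R), (Ioi s).indicator (fun r => ENNReal.ofReal r⁻¹) r := by
  rcases hs.eq_or_lt with h0 | hs0
  · rw [← h0, div_zero, Real.log_zero, ENNReal.ofReal_zero]
    exact bot_le
  by_cases hs4 : s < 4 * R
  · rw [lintegral_indicator measurableSet_Ioi, Measure.restrict_restrict measurableSet_Ioi]
    have hset : Ioi s ∩ Ioo 0 (4 * R) = Ioo s (4 * R) := by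
      ext r
      simp only [mem_inter_iff, mem_Ioi, mem_Ioo]
      constructor
      · rintro ⟨h1, _, h3⟩
        exact ⟨h1, h3⟩
      · rintro ⟨h1, h2⟩
        exact ⟨h1, hs0.trans h1, h2⟩
    rw [hset]
    have hint : IntegrableOn (fun r : ℝ => r⁻¹) (Ioo s (4 * R)) volume := by
      refine (ContinuousOn.integrableOn_Icc (continuousOn_inv₀.mono ?_)).mono_set Ioo_subset_Icc_self
      intro r hr
      exact ne_of_gt (hs0.trans_le hr.1)
    rw [← ofReal_integral_eq_lintegral_ofReal hint]
    · refine ENNReal.ofReal_le_ofReal (le_of_eq ?_)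
      rw [← integral_Ioc_eq_integral_Ioo, ← intervalIntegral.integral_of_le hs4.le, integral_inv_of_pos hs0 (by positivity)]
    · refine ae_restrict_of_forall_mem measurableSet_Ioo fun r hr => ?_
      exact inv_nonneg.2 (hs0.trans hr.1).le
  · have : Real.log (4 * R / s) ≤ 0 := by
      apply Real.log_nonpos (by positivity)
      rw [div_le_one hs0]
      exact not_lt.1 hs4
    rw [ENNReal.ofReal_of_nonpos this]
    exact bot_le

/-- A set of the closed disc `|·| ≤ R` has finite area, at most `πR²`. [folklore] -/
theorem volume_toReal_le_of_subset_closedBall {R : ℝ} (hR : 0 < R) {S : Set ℂ} (hSR : S ⊆ closedBall (0 : ℂ) R) :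
    volume S ≠ ⊤ ∧ (volume S).toReal ≤ π * R ^ 2 := by
  have hvol : volume (closedBall (0 : ℂ) R) = ENNReal.ofReal (π * R ^ 2) := by
    rw [Complex.volume_closedBall, ← ENNReal.ofReal_coe_nnreal, NNReal.coe_real_pi, ← ENNReal.ofReal_pow hR.le,
      ← ENNReal.ofReal_mul (by positivity), mul_comm]
  have hle : volume S ≤ ENNReal.ofReal (π * R ^ 2) := (measure_mono hSR).trans hvol.le
  refine ⟨ne_top_of_le_ne_top ENNReal.ofReal_ne_top hle, ?_⟩
  exact (ENNReal.toReal_mono ENNReal.ofReal_ne_top hle).trans (by rw [ENNReal.toReal_ofReal (by positivity)])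

/-- **Layer-cake bound for the logarithmic kernel on an ARBITRARY measurable set** `S` of the disc `|·| ≤ R` of positive area `|S|`:
for every `y`, `∫_S log (4R/|y − y'|) dA(y') ≤ (|S|/2) (1 + log (16πR²/|S|))` — Tonelli against `log(4R/s) = ∫_s^{4R} dr/r` gives
`∫_0^{4R} |S ∩ B(y,r)| dr/r`, and `|S ∩ B(y,r)| ≤ min(πr², |S|)` with the switch at `πr² = |S|`.  (Equality for a disc centred at `y`: this is
the bathtub value, reached without rearrangement.) [folklore] -/
theorem lintegral_log_le {R : ℝ} (hR : 0 < R) {S : Set ℂ} (hSR : S ⊆ closedBall (0 : ℂ) R)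
    (hS0 : 0 < (volume S).toReal) (y : ℂ) :
    ∫⁻ y' in S, ENNReal.ofReal (Real.log (4 * R / ‖y - y'‖)) ≤
      ENNReal.ofReal ((volume S).toReal / 2 * (1 + Real.log (16 * π * R ^ 2 / (volume S).toReal))) := by
  set m : ℝ := (volume S).toReal with hm
  obtain ⟨hSfin, hmle⟩ := volume_toReal_le_of_subset_closedBall hR hSR
  have hmS : volume S = ENNReal.ofReal m := (ENNReal.ofReal_toReal hSfin).symm
  -- the switch radius `r⋆ = √(m/π)`
  set rs : ℝ := Real.sqrt (m / π) with hrs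
  have hrs0 : 0 < rs := Real.sqrt_pos.2 (by positivity)
  have hrs2 : rs ^ 2 = m / π := Real.sq_sqrt (by positivity)
  have hrs4 : rs ≤ 4 * R := by
    have h1 : rs ^ 2 ≤ (4 * R) ^ 2 := by
      rw [hrs2, div_le_iff₀ Real.pi_pos]
      nlinarith [Real.pi_pos]
    exact (pow_le_pow_iff_left₀ hrs0.le (by positivity) two_ne_zero).1 h1
  -- the integrand after the switch of integrals
  set Φ : ℂ → ℝ → ℝ≥0∞ := fun y' r => (ball y r).indicator (fun _ => ENNReal.ofReal r⁻¹) y' with hΦ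
  have hΦm : AEMeasurable (uncurry Φ) ((volume.restrict S).prod (volume.restrict (Ioo 0 (4 * R)))) := by
    have hset : MeasurableSet {p : ℂ × ℝ | dist p.1 y < p.2} :=
      (isOpen_lt (continuous_fst.dist continuous_const) continuous_snd).measurableSet
    have hfun : Measurable fun p : ℂ × ℝ => ENNReal.ofReal p.2⁻¹ :=
      ENNReal.measurable_ofReal.comp (measurable_snd.inv)
    have heq : uncurry Φ = {p : ℂ × ℝ | dist p.1 y < p.2}.indicator fun p => ENNReal.ofReal p.2⁻¹ := by
      funext p
      rcases p with ⟨y', r⟩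
      by_cases h : dist y' y < r
      · have h1 : y' ∈ ball y r := h
        have h2 : (y', r) ∈ {p : ℂ × ℝ | dist p.1 y < p.2} := h
        simp only [uncurry, hΦ, indicator_of_mem h1, indicator_of_mem h2]
      · have h1 : y' ∉ ball y r := h
        have h2 : (y', r) ∉ {p : ℂ × ℝ | dist p.1 y < p.2} := h
        simp only [uncurry, hΦ, indicator_of_notMem h1, indicator_of_notMem h2]
    rw [heq]
    exact (hfun.indicator hset).aemeasurable
  -- pointwise: the logarithm as an integral of the ball indicators
  have hpt : ∀ y' : ℂ, ENNReal.ofReal (Real.log (4 * R / ‖y - y'‖)) ≤ ∫⁻ r in Ioo 0 (4 * R), Φ y' r := by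
    intro y'
    refine (ofReal_log_le_lintegral_indicator hR (norm_nonneg (y - y'))).trans (le_of_eq ?_)
    refine lintegral_congr fun r => ?_
    have hiff : r ∈ Ioi ‖y - y'‖ ↔ y' ∈ ball y r := by
      rw [mem_Ioi, mem_ball, dist_eq_norm, norm_sub_rev]
    by_cases h : r ∈ Ioi ‖y - y'‖
    · rw [indicator_of_mem h, hΦ]
      beta_reduce
      rw [indicator_of_mem (hiff.1 h)]
    · rw [indicator_of_notMem h, hΦ]
      beta_reduce
      rw [indicator_of_notMem (fun h' => h (hiff.2 h'))]
  -- the inner integral after the switch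
  have hinner : ∀ r : ℝ, ∫⁻ y' in S, Φ y' r = ENNReal.ofReal r⁻¹ * volume (ball y r ∩ S) := by
    intro r
    rw [hΦ]
    beta_reduce
    rw [lintegral_indicator_const measurableSet_ball, Measure.restrict_apply measurableSet_ball]
  -- the two regimes
  have hsmall : ∀ r ∈ Ioc (0 : ℝ) rs, ENNReal.ofReal r⁻¹ * volume (ball y r ∩ S) ≤ ENNReal.ofReal (π * r) := by
    intro r hr
    have hr0 : 0 < r := hr.1
    calc ENNReal.ofReal r⁻¹ * volume (ball y r ∩ S) ≤ ENNReal.ofReal r⁻¹ * volume (ball y r) := by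
          gcongr
          exact inter_subset_left
      _ = ENNReal.ofReal (π * r) := by
          rw [Complex.volume_ball, ← ENNReal.ofReal_coe_nnreal, NNReal.coe_real_pi, ← ENNReal.ofReal_pow hr0.le,
            ← ENNReal.ofReal_mul (by positivity), ← ENNReal.ofReal_mul (by positivity)]
          congr 1
          field_simp
  have hlarge : ∀ r : ℝ, ENNReal.ofReal r⁻¹ * volume (ball y r ∩ S) ≤ ENNReal.ofReal (r⁻¹ * m) := by
    intro r
    calc ENNReal.ofReal r⁻¹ * volume (ball y r ∩ S) ≤ ENNReal.ofReal r⁻¹ * volume S := by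
          gcongr
          exact inter_subset_right
      _ ≤ ENNReal.ofReal (r⁻¹ * m) := by
          by_cases hr : 0 ≤ r
          · rw [hmS, ← ENNReal.ofReal_mul (inv_nonneg.2 hr)]
          · have hr' : r⁻¹ ≤ 0 := inv_nonpos.2 (le_of_lt (not_le.1 hr))
            rw [ENNReal.ofReal_of_nonpos hr', zero_mul]
            exact bot_le
  -- the two pieces
  have hpiece1 : ∫⁻ r in Ioc (0 : ℝ) rs, ENNReal.ofReal (π * r) = ENNReal.ofReal (m / 2) := by
    have hint : IntegrableOn (fun r : ℝ => π * r) (Ioc 0 rs) volume :=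
      (Continuous.integrableOn_Icc (by fun_prop)).mono_set Ioc_subset_Icc_self
    rw [← ofReal_integral_eq_lintegral_ofReal hint]
    · congr 1
      rw [← intervalIntegral.integral_of_le hrs0.le, intervalIntegral.integral_const_mul, integral_id, hrs2]
      field_simp
      ring
    · exact ae_restrict_of_forall_mem measurableSet_Ioc fun r hr => by
        have := hr.1
        positivity
  have hpiece2 : ∫⁻ r in Ioo rs (4 * R), ENNReal.ofReal (r⁻¹ * m) ≤ ENNReal.ofReal (m * Real.log (4 * R / rs)) := by
    rcases hrs4.eq_or_lt with h | h
    · rw [h, Ioo_self, Measure.restrict_empty, lintegral_zero_measure]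
      exact bot_le
    have hint : IntegrableOn (fun r : ℝ => r⁻¹ * m) (Ioo rs (4 * R)) volume := by
      refine (ContinuousOn.integrableOn_Icc ((continuousOn_inv₀.mono ?_).mul continuousOn_const)).mono_set
        Ioo_subset_Icc_self
      intro r hr
      exact ne_of_gt (hrs0.trans_le hr.1)
    rw [← ofReal_integral_eq_lintegral_ofReal hint]
    · refine ENNReal.ofReal_le_ofReal (le_of_eq ?_)
      rw [← integral_Ioc_eq_integral_Ioo, ← intervalIntegral.integral_of_le h.le, intervalIntegral.integral_mul_const,
        integral_inv_of_pos hrs0 (by positivity), mul_comm]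
    · refine ae_restrict_of_forall_mem measurableSet_Ioo fun r hr => ?_
      have : 0 < r := hrs0.trans hr.1
      positivity
  -- the logarithm bookkeeping: `m log (4R/r⋆) = (m/2) log (16πR²/m)`
  have hlog : m * Real.log (4 * R / rs) = m / 2 * Real.log (16 * π * R ^ 2 / m) := by
    have h1 : 16 * π * R ^ 2 / m = (4 * R / rs) ^ 2 := by
      rw [div_pow, hrs2]
      field_simp
      ring
    rw [h1, Real.log_pow]
    push_cast
    ring
  have hlog0 : 0 ≤ Real.log (4 * R / rs) := Real.log_nonneg (by rw [le_div_iff₀ hrs0]; linarith)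
  -- assemble
  calc ∫⁻ y' in S, ENNReal.ofReal (Real.log (4 * R / ‖y - y'‖))
      ≤ ∫⁻ y' in S, ∫⁻ r in Ioo 0 (4 * R), Φ y' r := lintegral_mono fun y' => hpt y'
    _ = ∫⁻ r in Ioo 0 (4 * R), ∫⁻ y' in S, Φ y' r := lintegral_lintegral_swap hΦm
    _ = ∫⁻ r in Ioo 0 (4 * R), ENNReal.ofReal r⁻¹ * volume (ball y r ∩ S) := by simp_rw [hinner]
    _ ≤ ∫⁻ r in Ioc 0 rs ∪ Ioo rs (4 * R), ENNReal.ofReal r⁻¹ * volume (ball y r ∩ S) := by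
        refine lintegral_mono_set fun r hr => ?_
        rcases le_or_gt r rs with h | h
        · exact Or.inl ⟨hr.1, h⟩
        · exact Or.inr ⟨h, hr.2⟩
    _ ≤ (∫⁻ r in Ioc 0 rs, ENNReal.ofReal r⁻¹ * volume (ball y r ∩ S)) +
          ∫⁻ r in Ioo rs (4 * R), ENNReal.ofReal r⁻¹ * volume (ball y r ∩ S) := lintegral_union_le _ _ _
    _ ≤ (∫⁻ r in Ioc 0 rs, ENNReal.ofReal (π * r)) + ∫⁻ r in Ioo rs (4 * R), ENNReal.ofReal (r⁻¹ * m) :=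
        add_le_add (setLIntegral_mono' measurableSet_Ioc hsmall) (lintegral_mono fun r => hlarge r)
    _ ≤ ENNReal.ofReal (m / 2) + ENNReal.ofReal (m * Real.log (4 * R / rs)) := add_le_add hpiece1.le hpiece2
    _ = ENNReal.ofReal (m / 2 * (1 + Real.log (16 * π * R ^ 2 / m))) := by
        rw [← ENNReal.ofReal_add (by positivity) (by positivity), hlog]
        congr 1
        ring

/-! ### The double integral of the two-pole kernel -/

/-- **THE DOUBLE TWO-POLE BOUND**: for a measurable `S` of the disc `|·| ≤ R` with positive area `|S|`,
`∫_S ∫_S ∫_{|x| ≤ R} dA(x) dA(y') dA(y) / (|x−y| |x−y'|) ≤ 2π |S|² (3 + log (16πR²/|S|))` — i.e. the Newtonian potential of `S` has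
`‖U_S‖²_{L²(B̄_R)} ≤ 2π|S|²(3 + log(16πR²/|S|))`, the logarithmic growth that makes the planar capacity of `S` at least `≍ 1/log(R²/|S|)`.
[folklore] -/
theorem doublePole_le {R : ℝ} (hR : 0 < R) {S : Set ℂ} (hSm : MeasurableSet S) (hSR : S ⊆ closedBall (0 : ℂ) R)
    (hS0 : 0 < (volume S).toReal) :
    ∫⁻ y in S, ∫⁻ y' in S, ∫⁻ x in closedBall (0 : ℂ) R, ENNReal.ofReal (‖x - y‖⁻¹ * ‖x - y'‖⁻¹) ≤
      ENNReal.ofReal (2 * π * (volume S).toReal ^ 2 * (3 + Real.log (16 * π * R ^ 2 / (volume S).toReal))) := by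
  set m : ℝ := (volume S).toReal with hm
  obtain ⟨hSfin, hmle⟩ := volume_toReal_le_of_subset_closedBall hR hSR
  have hmS : volume S = ENNReal.ofReal m := (ENNReal.ofReal_toReal hSfin).symm
  have hlog16 : 0 ≤ Real.log (16 * π * R ^ 2 / m) := by
    refine Real.log_nonneg ?_
    rw [le_div_iff₀ hS0]
    nlinarith [Real.pi_pos]
  have hnormR : ∀ w ∈ S, ‖w‖ ≤ R := fun w hw => by simpa using hSR hw
  -- the inner integral
  have hinner : ∀ y ∈ S, ∫⁻ y' in S, ∫⁻ x in closedBall (0 : ℂ) R, ENNReal.ofReal (‖x - y‖⁻¹ * ‖x - y'‖⁻¹) ≤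
      ENNReal.ofReal (2 * π * m * (3 + Real.log (16 * π * R ^ 2 / m))) := by
    intro y hy
    have hyR := hnormR y hy
    have hae : ∀ᵐ y' ∂(volume : Measure ℂ), y' ≠ y := by
      have h : (volume : Measure ℂ) {y} = 0 := measure_singleton y
      rw [ae_iff]
      simpa only [ne_eq, not_not, setOf_eq_eq_singleton] using h
    calc ∫⁻ y' in S, ∫⁻ x in closedBall (0 : ℂ) R, ENNReal.ofReal (‖x - y‖⁻¹ * ‖x - y'‖⁻¹)
        ≤ ∫⁻ y' in S, ENNReal.ofReal (4 * π) + ENNReal.ofReal (4 * π) * ENNReal.ofReal (Real.log (4 * R / ‖y - y'‖)) := by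
          refine setLIntegral_mono_ae' hSm ?_
          filter_upwards [hae] with y' hne hy'
          have hy'R := hnormR y' hy'
          have hd : 0 < ‖y - y'‖ := norm_pos_iff.2 (sub_ne_zero.2 hne.symm)
          have hlog : 0 ≤ Real.log (4 * R / ‖y - y'‖) := by
            refine Real.log_nonneg ?_
            rw [le_div_iff₀ hd]
            calc 1 * ‖y - y'‖ = ‖y - y'‖ := one_mul _
              _ ≤ ‖y‖ + ‖y'‖ := norm_sub_le _ _
              _ ≤ R + R := add_le_add hyR hy'R
              _ ≤ 4 * R := by linarith
          refine (twoPole_log_le hyR hy'R hne.symm).trans (le_of_eq ?_)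
          rw [← ENNReal.ofReal_mul (by positivity), ← ENNReal.ofReal_add (by positivity) (by positivity)]
          congr 1
          ring
      _ = ENNReal.ofReal (4 * π) * volume S + ENNReal.ofReal (4 * π) * ∫⁻ y' in S, ENNReal.ofReal (Real.log (4 * R / ‖y - y'‖)) := by
          rw [lintegral_add_left measurable_const, setLIntegral_const, lintegral_const_mul' _ _ ENNReal.ofReal_ne_top]
      _ ≤ ENNReal.ofReal (4 * π) * ENNReal.ofReal m +
            ENNReal.ofReal (4 * π) * ENNReal.ofReal (m / 2 * (1 + Real.log (16 * π * R ^ 2 / m))) := by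
          gcongr
          · exact hmS.le
          · exact lintegral_log_le hR hSR hS0 y
      _ = ENNReal.ofReal (2 * π * m * (3 + Real.log (16 * π * R ^ 2 / m))) := by
          rw [← ENNReal.ofReal_mul (by positivity), ← ENNReal.ofReal_mul (by positivity),
            ← ENNReal.ofReal_add (by positivity) (by positivity)]
          congr 1
          ring
  calc ∫⁻ y in S, ∫⁻ y' in S, ∫⁻ x in closedBall (0 : ℂ) R, ENNReal.ofReal (‖x - y‖⁻¹ * ‖x - y'‖⁻¹)
      ≤ ∫⁻ _ in S, ENNReal.ofReal (2 * π * m * (3 + Real.log (16 * π * R ^ 2 / m))) := setLIntegral_mono' hSm hinner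
    _ = ENNReal.ofReal (2 * π * m * (3 + Real.log (16 * π * R ^ 2 / m))) * volume S := by
        rw [setLIntegral_const]
    _ = ENNReal.ofReal (2 * π * m ^ 2 * (3 + Real.log (16 * π * R ^ 2 / m))) := by
        rw [hmS, ← ENNReal.ofReal_mul (by positivity)]
        congr 1
        ring

end Summit.NavierStokesRegularity.NavierStokesRegularity.Theorems.PowerGaugeEulerLiouville.SwirlCapacity

end
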